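import Literature.Analysis.FunctionSpaces.TorusHolderBridge
import HarnessLib

/-!
# Discharged fact: `C^{0,r}(T^d)` through the periodic lift is the intrinsic `C^{0,r}_b(T^d)`

`Literature.Analysis.FunctionSpaces.HolderNorm` records as a named fact
(`Literature.Analysis.FunctionSpaces.Torus.memContDiffHolder_zero_iff : Prop`) that, for a Hölder
exponent `0 < r`, a function `f : T^d → Y` on the flat torus `UnitAddTorus d = d → ℝ/ℤ` lies in
`C^{0,r}(T^d)` in the *lifted* sense (`Torus.MemContDiffHolder 0 r f`: the periodic lift
`Torus.lift f = f ∘ proj : ℝ^d → Y` is `C⁰`, bounded, and `r`-Hölder for the Euclidean metric of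
`ℝ^d`) if and only if it lies in the bounded Hölder class `MemBoundedHolder r f` for the
*intrinsic* product (sup of quotient norms) metric of `(ℝ/ℤ)^d`. This file proves it
(`Literature.Analysis.FunctionSpaces.Torus.memContDiffHolder_zero_iff_holds`), so users holding
`(h : Torus.memContDiffHolder_zero_iff)` can discharge the hypothesis.

Source of the conventions. De Lellis–Székelyhidi, *Dissipative continuous Euler flows*
(arXiv:1202.1751 = Invent. Math. 193 (2013)): §1, "`T³` denotes the 3-dimensional torus, i.e.
`T³ = S¹ × S¹ × S¹`"; §5 "Schauder estimates" (arXiv numbering), opening paragraph: "the supremum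
norm is denoted by `‖f‖₀ := sup_{T³} |f|`. We define the Hölder seminorms as
`[f]_m = max_{|β| = m} ‖D^β f‖₀`, `[f]_{m+α} = max_{|β| = m} sup_{x ≠ y} |D^β f(x) − D^β f(y)| / |x − y|^α`.
The Hölder norms are then given by `‖f‖_m = ∑_{j ≤ m} [f]_j`, `‖f‖_{m+α} = ‖f‖_m + [f]_{m+α}`" —
functions on `T³` being periodic functions on `ℝ³` and `|x − y|` the Euclidean distance, which is
the lifted convention `Torus.MemContDiffHolder`. The fact is the elementary (folklore) remark that
for `m = 0` this class coincides with the Hölder class of the compact metric space `(ℝ/ℤ)^d`; the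
paper fixes the conventions and does not spell the remark out.

## Proof

* `proj : ℝ^d → T^d` is `1`-Lipschitz (`Torus.lipschitzWith_proj`: coordinatewise
  `‖(s : ℝ/ℤ)‖ ≤ |s|`, `QuotientAddGroup.norm_mk_le_norm`, and `|x i − y i| ≤ ‖x − y‖₂`,
  `PiLp.dist_apply_le`), hence `HolderWith C r f → HolderWith C r (lift f)` (`Torus.HolderWith.lift`).
* Conversely `Torus.HolderWith.of_lift` (`TorusHolderBridge`, good lifts: two points of `T^d` have
  representatives at Euclidean distance `≤ √d · dist`) gives `HolderWith (C (√d)^r) r f` from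
  `HolderWith C r (lift f)`; so `MemHolder r (lift f) ↔ MemHolder r f` (`Torus.memHolder_lift_iff`).
* Sup norms agree, `Torus.eSupNorm_lift` (`proj` is onto); hence
  `MemBoundedHolder r (lift f) ↔ MemBoundedHolder r f` (`Torus.memBoundedHolder_lift_iff`), for
  every `r ≥ 0`.
* The hypothesis `0 < r` enters only through the already proved Euclidean statement
  `Literature.Analysis.FunctionSpaces.memContDiffHolder_zero_iff`
  (`MemContDiffHolder 0 r g ↔ MemBoundedHolder r g`: `r`-Hölder with `0 < r` implies `C⁰`).

## References

* C. De Lellis, L. Székelyhidi Jr., *Dissipative continuous Euler flows*, Invent. Math. 193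
  (2013), 377–407, arXiv:1202.1751: §1 (the torus `T³ = S¹ × S¹ × S¹`), §5 (arXiv numbering),
  opening paragraph (Hölder norms `‖f‖₀`, `[f]_{m+α}`, `‖f‖_{m+α}` on `T³`).
* D. Gilbarg, N. Trudinger, *Elliptic PDE of second order* (2001), §4.1 (Hölder spaces).
-/

open Set
open scoped NNReal ENNReal

noncomputable section

namespace Literature.Analysis.FunctionSpaces

namespace Torus

variable {d : Type*} [Fintype d]

/-- The covering map `proj : ℝ^d → T^d = (ℝ/ℤ)^d` is `1`-Lipschitz from the Euclidean metric to
the intrinsic (sup of quotient norms) metric: coordinatewise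
`dist (proj x i) (proj y i) = ‖(x i − y i : ℝ/ℤ)‖ ≤ |x i − y i| ≤ ‖x − y‖₂`. [folklore] -/
theorem lipschitzWith_proj : LipschitzWith 1 (proj : EuclideanSpace ℝ d → UnitAddTorus d) := by
  refine LipschitzWith.mk_one fun x y => ?_
  refine (dist_pi_le_iff dist_nonneg).2 fun i => ?_
  calc dist (proj x i) (proj y i) = ‖((x i - y i : ℝ) : UnitAddCircle)‖ := by
        rw [dist_eq_norm, proj_apply, proj_apply, ← AddCircle.coe_sub]
    _ ≤ ‖x i - y i‖ := QuotientAddGroup.norm_mk_le_norm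
    _ = dist (x i) (y i) := (dist_eq_norm _ _).symm
    _ ≤ dist x y := PiLp.dist_apply_le x y i

variable {Y : Type*} [NormedAddCommGroup Y] {r : ℝ≥0} {f : UnitAddTorus d → Y}

/-- Hölder continuity passes to the periodic lift with the same constant and exponent: if `f` is
`r`-Hölder with constant `C` for the intrinsic metric of `T^d`, then `lift f = f ∘ proj` is
`r`-Hölder with constant `C` on `ℝ^d` (`proj` is `1`-Lipschitz). Companion of
`Torus.HolderWith.of_lift`. [folklore] -/
theorem HolderWith.lift {C : ℝ≥0} (h : HolderWith C r f) : HolderWith C r (lift f) := by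
  intro x y
  calc edist (Torus.lift f x) (Torus.lift f y) = edist (f (proj x)) (f (proj y)) := rfl
    _ ≤ C * edist (proj x) (proj y) ^ (r : ℝ) := h _ _
    _ ≤ C * edist x y ^ (r : ℝ) := by
        gcongr
        simpa using lipschitzWith_proj x y

/-- `lift f` is `r`-Hölder on `ℝ^d` iff `f` is `r`-Hölder on `T^d` (constants `C ↦ C`, resp.
`C ↦ C (√d)^r` via good lifts, `Torus.HolderWith.of_lift`). [folklore] -/
theorem memHolder_lift_iff : MemHolder r (lift f) ↔ MemHolder r f :=
  ⟨fun ⟨_, hC⟩ => ⟨_, HolderWith.of_lift hC⟩, fun ⟨C, hC⟩ => ⟨C, HolderWith.lift hC⟩⟩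

/-- `lift f ∈ C^{0,r}_b(ℝ^d)` iff `f ∈ C^{0,r}_b(T^d)` (for every exponent `r ≥ 0`): the sup norms
agree (`Torus.eSupNorm_lift`) and the Hölder seminorms are equivalent (`Torus.memHolder_lift_iff`).
[folklore] -/
theorem memBoundedHolder_lift_iff : MemBoundedHolder r (lift f) ↔ MemBoundedHolder r f := by
  rw [memBoundedHolder_iff, memBoundedHolder_iff, ← eSupNorm_lt_top_iff, ← eSupNorm_lt_top_iff,
    eSupNorm_lift, memHolder_lift_iff]

variable [NormedSpace ℝ Y]

/-- Discharge of the named fact `Torus.memContDiffHolder_zero_iff`: for `0 < r`,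
`C^{0,r}(T^d)` defined through the periodic lift (`Torus.MemContDiffHolder 0 r f`: `lift f` is
`C⁰`, bounded and `r`-Hölder on `ℝ^d`) coincides with the bounded Hölder class
`MemBoundedHolder r f` for the intrinsic metric of `T^d = (ℝ/ℤ)^d`. Proof: the Euclidean
statement `memContDiffHolder_zero_iff` (`0 < r` makes Hölder functions continuous) reduces it to
`MemBoundedHolder r (lift f) ↔ MemBoundedHolder r f`, which is `Torus.memBoundedHolder_lift_iff`
(`proj` is `1`-Lipschitz; good lifts; equal sup norms). The lifted convention is that of
De Lellis–Székelyhidi, arXiv:1202.1751 §1 (`T³ = S¹ × S¹ × S¹`) and §5 (arXiv numbering), opening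
paragraph: `‖f‖₀ := sup_{T³} |f|`, `[f]_α = sup_{x ≠ y} |f(x) − f(y)| / |x − y|^α`,
`‖f‖_α = ‖f‖₀ + [f]_α`, for periodic functions with the Euclidean `|x − y|`.
[cite: DeLellisSzekelyhidiInvent2013, §1 and §5 (arXiv numbering) opening paragraph, Hölder norms on the torus] -/
theorem memContDiffHolder_zero_iff_holds : Torus.memContDiffHolder_zero_iff (d := d) (Y := Y) := by
  intro r f hr
  unfold Torus.MemContDiffHolder
  rw [Literature.Analysis.FunctionSpaces.memContDiffHolder_zero_iff hr]
  exact memBoundedHolder_lift_iff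

end Torus

end Literature.Analysis.FunctionSpaces

end
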